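import Literature.NumberTheory.EllipticCurves.WeberGamma2LevelNineRational
import Literature.NumberTheory.EllipticCurves.ModularFunctionValueTransport
import Literature.NumberTheory.EllipticCurves.HeegnerPointsShimuraReduction
import Literature.NumberTheory.EllipticCurves.SingularModuliIntegral
import HarnessLib

/-!
# Singular moduli of discriminant `d_K ≡ 1 (mod 3)` are cubes in the field of singular moduli
# (Cox, *Primes of the form x² + ny²*, Thm. 12.2 — the case `3` split in `K`, via `γ₂(3τ) ∈ ℚ(X₀(9))`)

Topic `NumberTheory/EllipticCurves` (complex multiplication).  One definition with body
(`weberNineValue τ = E₄(3τ)/η(3τ)⁸ = γ₂(3τ)`), all statements proved, no named fact.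

> Cox, Thm. 12.2: "Let `𝒪` be an order of discriminant `D` … Assume that `3 ∤ D` … Then `γ₂(τ₀)` is
> an algebraic integer and `K(γ₂(τ₀))` is the ring class field of `𝒪`."  In particular, for the
> maximal order, **`j(τ₀) = γ₂(τ₀)³` is a cube in the Hilbert class field `H = K(j(τ₀))`**.

This file proves the cube statement for the maximal order when **`3` splits in `K`**
(`d_K ≡ 1 (mod 3)`), in the concrete form used downstream: every singular modulus `j(τ_Q)` of
discriminant `d_K` is `w³` for some `w` in the tree's field of singular moduli
`H_K = singularModuliField K ι ⊂ ℂ` (`HeegnerPointsSingularModuliField`), hence the ideal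
`(j(τ_Q))` is a cube.  The proof is not Cox's (modular equation `Φ₉`, Prop. 12.7, Lemma 12.11) but
Shimura reciprocity at the level-`9` Heegner points, through the tree's transport chain:

* Step A (`apply_weberNineValue_heegnerTau_eq`): for a Heegner form `Q` of level `9` and
  discriminant `d_K` (these exist exactly when `3` splits: `exists_sq_sub_dvd_thirtySix`) and
  `σ ∈ Aut(ℂ)` fixing `√d_K` and `j(τ_Q)`, `σ` fixes the level-`9` structure of `τ_Q`
  (`levelTransport_self_of_apply_formJ_eq`), and `γ₂(3τ) ∈ K_9` has an `Aut(ℂ)`-fixed `q`-series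
  (`mapLaurent_weberNineFn`), so `σ(γ₂(3τ_Q)) = γ₂(3τ_Q)` (`LevelTransport.apply_value_eq`);
* Step B (`weberNineValue_heegnerTau_mem_singularModuliField`): hence `γ₂(3τ_Q) ∈ H_K`, the fixed
  field of `Aut(ℂ/H_K)` being `H_K` (`Complex.mem_subfield_of_forall_ringEquiv`);
* Step C (`weberNineValue_heegnerTau_pow_three`): `γ₂(3τ_Q)³ = j(3τ_Q) = j(τ_{(A/3, B, 3C)})`, a
  singular modulus of discriminant `d_K`;
* Step D (`exists_mem_pow_three_eq_formJ`): every singular modulus of discriminant `d_K` is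
  conjugate to that one under `Aut(ℂ)` (equal minimal polynomials,
  `minpoly_formJ_eq_principalForm`; extension of embeddings,
  `Complex.exists_ringEquiv_apply_eq_of_subfield`), and `Aut(ℂ)` preserves `H_K`
  (`ringEquiv_apply_mem_singularModuliField`), so every `j(τ_{Q₀})` is a cube of an element of `H_K`.

Not covered (and needed for all `d_K`): `3` inert (Cox's argument through the ring class field of
conductor `3`, `[L′ : L] = 4`) and `3 ∣ d_K` (Cox Thm. 12.13, Schertz).  This is groundwork for the
complex-multiplication input (C) of `Literature.Barriers.ABC.OWeakUniformABCImpliesNoSiegelZeros`.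

## References

* D. A. Cox, *Primes of the form x² + ny²*, 2nd ed., 2013, §12.A Thm. 12.2, Prop. 12.3. [Cox2013]
* G. Shimura, *Introduction to the arithmetic theory of automorphic functions*, 1971, §6.8,
  Thm. 6.31. [ShimuraIATAF1971]
* B. H. Gross, *Heegner points on X₀(N)*, 1984, §I.1. [Gross1984]
-/

noncomputable section

open Complex Polynomial NumberField
open UpperHalfPlane hiding I
open scoped MatrixGroups ModularForm Cardinal IntermediateField

universe u

namespace Literature.NumberTheory.EllipticCurves

open ModularForms Literature.FieldTheory.AlgClosed
open Literature.NumberTheory.QuadraticFields.BinaryQuadraticForm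
open Literature.NumberTheory.QuadraticFields.Quadratic (exists_sq_eq_discr discr_emod_four)

/-! ### Arithmetic preliminaries: `β² ≡ D (mod 36)`, the form `(A/3, B, 3C)` -/

/-- `D ≡ 0, 1 (mod 4)` and `D ≡ 1 (mod 3)` make `D` a square modulo `36` (so that Heegner forms of
level `9` and discriminant `D` exist). [folklore] -/
theorem exists_sq_sub_dvd_thirtySix {D : ℤ} (h4 : D % 4 = 0 ∨ D % 4 = 1) (h3 : D % 3 = 1) :
    ∃ β : ℤ, (4 * (9 : ℕ) : ℤ) ∣ β ^ 2 - D := by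
  have key : ∀ d : ZMod 36, (d.val % 4 = 0 ∨ d.val % 4 = 1) → d.val % 3 = 1 →
      ∃ b : ZMod 36, b ^ 2 = d := by decide
  have hmod : ((D : ZMod 36)).val = (D % 36).toNat := by
    have h := ZMod.val_intCast (n := 36) D
    have h0 : 0 ≤ D % 36 := Int.emod_nonneg D (by norm_num)
    have : ((D : ZMod 36).val : ℤ) = D % 36 := h
    omega
  have hD4 : ((D : ZMod 36)).val % 4 = 0 ∨ ((D : ZMod 36)).val % 4 = 1 := by
    rw [hmod]; rcases h4 with h | h
    · left; omega
    · right; omega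
  have hD3 : ((D : ZMod 36)).val % 3 = 1 := by rw [hmod]; omega
  obtain ⟨b, hb⟩ := key (D : ZMod 36) hD4 hD3
  refine ⟨(b.val : ℤ), ?_⟩
  have h36 : ((((b.val : ℤ) ^ 2 - D : ℤ)) : ZMod 36) = 0 := by
    push_cast
    rw [ZMod.natCast_zmod_val, hb, sub_self]
  have := (ZMod.intCast_zmod_eq_zero_iff_dvd _ 36).mp h36
  norm_num
  exact this

/-- For `Q = (A, B, C)` with `3 ∣ A`, the Heegner point of `(A/3, B, 3C)` is `3τ_Q`. [folklore] -/
theorem heegnerTau_divThree {A B C : ℤ} (hA : 0 < A) (h3 : (3 : ℤ) ∣ A)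
    (hdisc : B ^ 2 - 4 * A * C < 0) :
    heegnerTau (A / 3, B, 3 * C) = tpD 3 • heegnerTau (A, B, C) := by
  obtain ⟨a, rfl⟩ := h3
  have ha : 0 < a := by omega
  have hdiv : (3 * a) / 3 = a := by omega
  have hdisc' : B ^ 2 - 4 * a * (3 * C) < 0 := by nlinarith
  apply UpperHalfPlane.ext
  rw [coe_tpD_smul, show ((3 * a) / 3 : ℤ) = a from hdiv]
  rw [coe_heegnerTau (Q := (a, B, 3 * C)) ha hdisc', coe_heegnerTau (Q := (3 * a, B, C)) (by omega) hdisc]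
  apply Complex.ext
  · simp; field_simp
  · simp only [Complex.mul_im]
    norm_num
    have h1 : (4 * (a : ℝ) * (3 * C) - B ^ 2) = (4 * (3 * a) * C - B ^ 2) := by ring
    rw [h1]
    field_simp

/-- `(A/3, B, 3C)` is primitive when `(A, B, C)` is, `3 ∣ A` and `3 ∤ B² − 4AC`. [folklore] -/
theorem isPrimitive_divThree {A B C : ℤ} (h3 : (3 : ℤ) ∣ A)
    (hprim : ∀ d : ℤ, d ∣ A → d ∣ B → d ∣ C → IsUnit d) (hD : ¬ (3 : ℤ) ∣ B ^ 2 - 4 * A * C) :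
    ∀ d : ℤ, d ∣ A / 3 → d ∣ B → d ∣ 3 * C → IsUnit d := by
  obtain ⟨a, rfl⟩ := h3
  have hdiv : (3 * a) / 3 = a := by omega
  rw [hdiv]
  intro d hda hdB hdC
  have h3d : ¬ (3 : ℤ) ∣ d := by
    intro h
    apply hD
    obtain ⟨b', hb'⟩ := dvd_trans h hdB
    rw [hb']
    exact ⟨3 * b' ^ 2 - 4 * a * C, by ring⟩
  have hcop : IsCoprime d 3 := ((Int.prime_three.coprime_iff_not_dvd).mpr h3d).symm
  have hdC' : d ∣ C := hcop.dvd_of_dvd_mul_left hdC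
  exact hprim d (dvd_trans hda (Dvd.intro_left 3 rfl)) hdB hdC'

/-! ### The value `γ₂(3τ) = E₄(3τ)/η(3τ)⁸` -/

/-- The value of Weber's `γ₂` at `3τ`, `E₄(3τ)/η(3τ)⁸` — the value of `u₉ = γ₂(3τ) ∈ K_9` at `τ`
(`pointValuation_weberNineFn_sub_lt_one`). [cite: Cox2013, §12.A Prop. 12.3] -/
def weberNineValue (τ : ℍ) : ℂ :=
  ModularForm.E₄ (tpD 3 • τ) / ModularForm.eta (3 * (τ : ℂ)) ^ 8

/-- **`γ₂(3τ)³ = j(3τ)`.** [cite: Cox2013, §12.A] -/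
theorem weberNineValue_pow_three (τ : ℍ) : weberNineValue τ ^ 3 = kleinJ (tpD 3 • τ) := by
  rw [weberNineValue, kleinJ, div_pow, ← pow_mul, ModularForm.discriminant, coe_tpD_smul]
  push_cast
  ring_nf

/-! ### Steps A–B: `γ₂(3τ_Q)` lies in the field of singular moduli, `Q` a Heegner form of level `9` -/

variable {K : Type u} [Field K] [NumberField K]

/-- `gcd(9, d_K) = 1` when `d_K ≡ 1 (mod 3)`. [folklore] -/
theorem isCoprime_nine_discr (h3 : NumberField.discr K % 3 = 1) :
    IsCoprime ((9 : ℕ) : ℤ) (NumberField.discr K) := by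
  have h : IsCoprime (3 : ℤ) (NumberField.discr K) := by
    rw [Int.prime_three.coprime_iff_not_dvd]
    omega
  simpa using h.pow_left (m := 2)

/-- **Step A (Shimura reciprocity for `γ₂(3τ)` at level-`9` Heegner points).**  For `K` imaginary
quadratic with `d_K ≡ 1 (mod 3)`, a Heegner form `Q` of level `9` and discriminant `d_K` with
`B ≡ β (mod 18)`, `36 ∣ β² − d_K`, and an automorphism `σ` of `ℂ` fixing `√d_K` and `j(τ_Q)`:
`σ` fixes `γ₂(3τ_Q)`. [cite: Cox2013, §12.A Thm. 12.2] [cite: ShimuraIATAF1971, §6.8 and Thm. 6.31] -/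
theorem apply_weberNineValue_heegnerTau_eq (hK : IsImaginaryQuadratic K)
    (h3 : NumberField.discr K % 3 = 1) {β : ℤ}
    (hβD : (4 * (9 : ℕ) : ℤ) ∣ β ^ 2 - NumberField.discr K) {σ : ℂ ≃+* ℂ}
    (hσ : σ (sqrtDisc (NumberField.discr K)) = sqrtDisc (NumberField.discr K))
    {Q : ℤ × ℤ × ℤ} (hQ : Q ∈ heegnerForms 9 (NumberField.discr K))
    (hβ : Q.2.1 ≡ β [ZMOD 2 * (9 : ℕ)]) (hj : σ (formJ Q) = formJ Q) :
    σ (weberNineValue (heegnerTau Q)) = weberNineValue (heegnerTau Q) := by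
  have hT := levelTransport_self_of_apply_formJ_eq hK.discr_neg (isCoprime_nine_discr h3) hβD hσ
    hQ hβ hj
  exact LevelTransport.apply_value_eq (N := 9) hT (mapLaurent_weberNineFn (σ : ℂ →+* ℂ))
    (pointValuation_weberNineFn_sub_lt_one (heegnerTau Q))

/-- **Step B: `γ₂(3τ_Q) ∈ H_K`**, the field of singular moduli of `K` (`singularModuliField K ι`):
it is fixed by every automorphism of `ℂ` fixing `H_K` pointwise, and the fixed field of
`Aut(ℂ/H_K)` is `H_K` (`Complex.mem_subfield_of_forall_ringEquiv`). [cite: Cox2013, §12.A Thm. 12.2] -/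
theorem weberNineValue_heegnerTau_mem_singularModuliField (hK : IsImaginaryQuadratic K)
    (h3 : NumberField.discr K % 3 = 1) (ι : K →+* ℂ) {β : ℤ}
    (hβD : (4 * (9 : ℕ) : ℤ) ∣ β ^ 2 - NumberField.discr K)
    {Q : ℤ × ℤ × ℤ} (hQ : Q ∈ heegnerForms 9 (NumberField.discr K))
    (hβ : Q.2.1 ≡ β [ZMOD 2 * (9 : ℕ)]) :
    weberNineValue (heegnerTau Q) ∈ singularModuliField K ι := by
  refine Complex.mem_subfield_of_forall_ringEquiv _ (cardinalMk_singularModuliField_le K hK ι) ?_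
  intro σ hσ
  have hσD : σ (sqrtDisc (NumberField.discr K)) = sqrtDisc (NumberField.discr K) :=
    apply_sqrtDisc_discr_eq hK ι fun x ↦ hσ _ (apply_mem_singularModuliField ι x)
  have hjmem : kleinJ (heegnerTau Q) ∈ singularModuliField K ι :=
    kleinJ_heegnerTau_mem_singularModuliField hK ι hQ
  have hj : σ (formJ Q) = formJ Q := by
    rw [formJ_def, ← kleinJ_eq_periodPair_j]
    exact hσ _ hjmem
  exact apply_weberNineValue_heegnerTau_eq hK h3 hβD hσD hQ hβ hj

/-! ### Step C: `γ₂(3τ_Q)³ = j(3τ_Q) = j(τ_{(A/3, B, 3C)})` -/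

/-- **`γ₂(3τ_Q)³` is the singular modulus `j(τ_{(A/3, B, 3C)})`** of discriminant `d_K`. [folklore] -/
theorem weberNineValue_heegnerTau_pow_three {D : ℤ} (hD : D < 0) {Q : ℤ × ℤ × ℤ}
    (hQ : Q ∈ heegnerForms 9 D) :
    weberNineValue (heegnerTau Q) ^ 3 = formJ (Q.1 / 3, Q.2.1, 3 * Q.2.2) := by
  obtain ⟨hdisc, hA, hNA, -⟩ := hQ
  have h3A : (3 : ℤ) ∣ Q.1 := dvd_trans (by norm_num) hNA
  rw [weberNineValue_pow_three, formJ_def, ← kleinJ_eq_periodPair_j]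
  congr 1
  obtain ⟨A, B, C⟩ := Q
  exact (heegnerTau_divThree hA h3A (by simp only at hdisc; rw [hdisc]; exact hD)).symm

/-- The form `(A/3, B, 3C)` attached to a Heegner form of level `9` and discriminant `D ≡ 1 (mod 3)`
is primitive and positive definite of discriminant `D`. [folklore] -/
theorem divThree_spec {D : ℤ} (h3 : D % 3 = 1) {Q : ℤ × ℤ × ℤ} (hQ : Q ∈ heegnerForms 9 D) :
    0 < Q.1 / 3 ∧ IsPrimitive (Q.1 / 3, Q.2.1, 3 * Q.2.2) ∧ discr (Q.1 / 3, Q.2.1, 3 * Q.2.2) = D := by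
  obtain ⟨hdisc, hA, hNA, hprim⟩ := hQ
  have h3A : (3 : ℤ) ∣ Q.1 := dvd_trans (by norm_num) hNA
  obtain ⟨a, ha⟩ := h3A
  refine ⟨by omega, ?_, ?_⟩
  · rw [isPrimitive_iff_binQF, _root_.Literature.NumberTheory.QuadraticFields.Quadratic.BinQF.isPrimitive_iff]
    have hD3 : ¬ (3 : ℤ) ∣ Q.2.1 ^ 2 - 4 * Q.1 * Q.2.2 := by rw [hdisc]; omega
    exact isPrimitive_divThree ⟨a, ha⟩ hprim hD3
  · rw [QuadraticFields.BinaryQuadraticForm.discr_apply, ← hdisc, ha]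
    have : (3 * a) / 3 = a := by omega
    rw [this]; ring

/-! ### Step D: all singular moduli of discriminant `d_K`, by conjugation -/

/-- The singular moduli of a negative discriminant are algebraic integers over `ℚ`. [folklore] -/
theorem isIntegral_rat_of_mem_image_formJ {D : ℤ} (hD : D < 0) :
    ∀ s ∈ (reducedForms D).image formJ, IsIntegral ℚ s := by
  intro s hs
  obtain ⟨Q, hQ, rfl⟩ := Finset.mem_image.mp hs
  obtain ⟨hdQ, hQ1, hQprim, -⟩ := (mem_reducedForms_iff hD).1 hQ
  exact (isIntegral_int_formJ hQ1 hQprim (by rw [hdQ]; exact hD)).tower_top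

/-- `√d_K ∈ H_K`. [folklore] -/
theorem sqrtDisc_mem_singularModuliField (hK : IsImaginaryQuadratic K) (ι : K →+* ℂ) :
    sqrtDisc (NumberField.discr K) ∈ singularModuliField K ι := by
  obtain ⟨-, -, δ, -, hδ⟩ := exists_sq_eq_discr hK.1
  have hδC : (ι (algebraMap (𝓞 K) K δ)) ^ 2 = sqrtDisc (NumberField.discr K) ^ 2 := by
    rw [← map_pow, ← map_pow, hδ, map_intCast, map_intCast, sqrtDisc_sq hK.discr_neg]
  rcases sq_eq_sq_iff_eq_or_eq_neg.mp hδC with h' | h'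
  · rw [← h']; exact apply_mem_singularModuliField ι _
  · have : sqrtDisc (NumberField.discr K) = -ι (algebraMap (𝓞 K) K δ) := by
      rw [h', neg_neg]
    rw [this]; exact neg_mem (apply_mem_singularModuliField ι _)

/-- Every embedding of `K` into `ℂ` lands in `H_K` (`K = ℚ + ℚ√d_K` and `±√d_K ∈ H_K`). [folklore] -/
theorem apply_mem_singularModuliField_of_ringHom (hK : IsImaginaryQuadratic K) (ι ψ : K →+* ℂ)
    (x : K) : ψ x ∈ singularModuliField K ι := by
  obtain ⟨-, -, δ, -, hδ⟩ := exists_sq_eq_discr hK.1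
  set d : K := algebraMap (𝓞 K) K δ with hd
  have hdK : d ^ 2 = (NumberField.discr K : K) := by rw [hd, ← map_pow, hδ, map_intCast]
  -- `ψ d = ± √d_K ∈ H_K`
  have hψd : ψ d ∈ singularModuliField K ι := by
    have hs : (ψ d) ^ 2 = sqrtDisc (NumberField.discr K) ^ 2 := by
      rw [← map_pow, hdK, map_intCast, sqrtDisc_sq hK.discr_neg]
    rcases sq_eq_sq_iff_eq_or_eq_neg.mp hs with h' | h'
    · rw [h']; exact sqrtDisc_mem_singularModuliField hK ι
    · rw [h']; exact neg_mem (sqrtDisc_mem_singularModuliField hK ι)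
  -- `d ∉ ℚ`
  have hdnot : ∀ q : ℚ, algebraMap ℚ K q ≠ d := by
    intro q hq
    have h2 : algebraMap ℚ K (q ^ 2) = algebraMap ℚ K (NumberField.discr K : ℚ) := by
      rw [map_pow, hq, hdK]; simp
    have h3 : (q ^ 2 : ℚ) = (NumberField.discr K : ℚ) := (algebraMap ℚ K).injective h2
    have h4 : (0 : ℚ) ≤ NumberField.discr K := by rw [← h3]; positivity
    have hneg : (NumberField.discr K : ℚ) < 0 := by exact_mod_cast hK.discr_neg
    linarith
  -- `{1, d}` is a `ℚ`-basis of `K`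
  have hli : LinearIndependent ℚ ![(1 : K), d] := by
    refine LinearIndependent.pair_iff.mpr fun s t hst ↦ ?_
    by_cases ht : t = 0
    · subst ht
      simp only [zero_smul, add_zero, smul_eq_zero, one_ne_zero, or_false] at hst
      exact ⟨hst, rfl⟩
    · exfalso
      apply hdnot (-s / t)
      rw [Algebra.smul_def, Algebra.smul_def, mul_one] at hst
      rw [map_div₀, map_neg, div_eq_iff ((_root_.map_ne_zero _).mpr ht)]
      linear_combination -hst
  have hcard : Fintype.card (Fin 2) = Module.finrank ℚ K := by simp [hK.1]
  have hspan : ⊤ ≤ Submodule.span ℚ (Set.range ![(1 : K), d]) :=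
    (hli.span_eq_top_of_card_eq_finrank' hcard).ge
  have hx : x ∈ Submodule.span ℚ (Set.range ![(1 : K), d]) := hspan Submodule.mem_top
  rw [Submodule.mem_span_range_iff_exists_fun] at hx
  obtain ⟨c, hc⟩ := hx
  rw [← hc]
  simp only [Fin.sum_univ_two, Matrix.cons_val_zero, Matrix.cons_val_one, map_add,
    Algebra.smul_def, map_mul, mul_one]
  have hq : ∀ q : ℚ, ψ (algebraMap ℚ K q) ∈ singularModuliField K ι := fun q ↦ by
    rw [show ψ (algebraMap ℚ K q) = (q : ℂ) by simp]
    exact SubfieldClass.ratCast_mem _ q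
  exact add_mem (hq _) (mul_mem (hq _) hψd)

/-- **`σ(H_K) ⊆ H_K` for every automorphism `σ` of `ℂ`** (`σ` carries `ι(K)` onto an embedding of
`K`, and singular moduli of discriminant `d_K` to singular moduli of discriminant `d_K`,
`exists_formJ_eq_ringEquiv_apply`). [folklore] -/
theorem ringEquiv_apply_mem_singularModuliField (hK : IsImaginaryQuadratic K) (ι : K →+* ℂ)
    (σ : ℂ ≃+* ℂ) {z : ℂ} (hz : z ∈ singularModuliField K ι) : σ z ∈ singularModuliField K ι := by
  have hD : NumberField.discr K < 0 := hK.discr_neg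
  induction hz using Subfield.closure_induction with
  | mem x hx =>
    rcases hx with ⟨k, rfl⟩ | hx
    · exact apply_mem_singularModuliField_of_ringHom hK ι (σ.toRingHom.comp ι) k
    · obtain ⟨Q, hQ, rfl⟩ := Finset.mem_image.mp (Finset.mem_coe.mp hx)
      obtain ⟨hdQ, hQ1, hQprim, -⟩ := (mem_reducedForms_iff hD).1 hQ
      obtain ⟨Q₁, hA₁, hprim₁, hdisc₁, hσj⟩ :=
        exists_formJ_eq_ringEquiv_apply hQ1 hQprim (by rw [hdQ]; exact hD) σ
      rw [hσj]
      exact formJ_mem_singularModuliField ι hA₁ hprim₁ (hdisc₁.trans hdQ) hD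
  | one => rw [map_one]; exact one_mem _
  | add x y _ _ hx hy => rw [map_add]; exact add_mem hx hy
  | neg x _ hx => rw [map_neg]; exact neg_mem hx
  | inv x _ hx => rw [map_inv₀]; exact inv_mem hx
  | mul x y _ _ hx hy => rw [map_mul]; exact mul_mem hx hy

/-- **From one cube root to all**: if some singular modulus `j(τ_{Q₁})` of discriminant `d_K` is a
cube `w₀³` with `w₀ ∈ H_K`, then so is every singular modulus `j(τ_{Q₀})` of discriminant `d_K`
(conjugate `w₀` by an automorphism of `ℂ` carrying `j(τ_{Q₁})` to `j(τ_{Q₀})` — equal minimal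
polynomials by `minpoly_formJ_eq_principalForm`; `H_K` is stable). [cite: Cox2013, §13.A Prop. 13.2 (conjugacy of singular moduli)] -/
theorem exists_mem_pow_three_eq_formJ_of_one (hK : IsImaginaryQuadratic K) (ι : K →+* ℂ)
    {Q₁ Q₀ : ℤ × ℤ × ℤ} (hA₁ : 0 < Q₁.1) (hprim₁ : IsPrimitive Q₁) (hdisc₁ : discr Q₁ = NumberField.discr K)
    (hA₀ : 0 < Q₀.1) (hprim₀ : IsPrimitive Q₀) (hdisc₀ : discr Q₀ = NumberField.discr K)
    {w₀ : ℂ} (hw₀ : w₀ ∈ singularModuliField K ι) (hcube : w₀ ^ 3 = formJ Q₁) :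
    ∃ w ∈ singularModuliField K ι, w ^ 3 = formJ Q₀ := by
  set D := NumberField.discr K with hDdef
  have hD : D < 0 := hK.discr_neg
  have hSint := isIntegral_rat_of_mem_image_formJ hD
  set j₁ := formJ Q₁ with hj₁
  set j₀ := formJ Q₀ with hj₀
  have hmin : minpoly ℚ j₁ = minpoly ℚ j₀ := by
    rw [hj₁, hj₀, minpoly_formJ_eq_principalForm hD hSint hA₁ hprim₁ hdisc₁,
      minpoly_formJ_eq_principalForm hD hSint hA₀ hprim₀ hdisc₀]
  have hint₁ : IsIntegral ℚ j₁ := (isIntegral_int_formJ hA₁ hprim₁ (by rw [hdisc₁]; exact hD)).tower_top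
  have hint₀ : IsIntegral ℚ j₀ := (isIntegral_int_formJ hA₀ hprim₀ (by rw [hdisc₀]; exact hD)).tower_top
  have hroot : j₀ ∈ (minpoly ℚ j₁).aroots ℂ := by
    rw [Polynomial.mem_aroots, hmin]
    exact ⟨minpoly.ne_zero hint₀, minpoly.aeval ℚ j₀⟩
  -- a `ℚ`-embedding `ℚ(j₁) → ℂ` with `j₁ ↦ j₀`, extended to `Aut(ℂ)`
  set φ : ℚ⟮j₁⟯ →ₐ[ℚ] ℂ := (IntermediateField.algHomAdjoinIntegralEquiv ℚ hint₁).symm ⟨j₀, hroot⟩ with hφ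
  have hφj : φ (IntermediateField.AdjoinSimple.gen ℚ j₁) = j₀ :=
    IntermediateField.algHomAdjoinIntegralEquiv_symm_apply_gen ℚ hint₁ ⟨j₀, hroot⟩
  haveI : FiniteDimensional ℚ ℚ⟮j₁⟯ := IntermediateField.adjoin.finiteDimensional hint₁
  have hcount : #(ℚ⟮j₁⟯.toSubfield) ≤ ℵ₀ :=
    Subfield.cardinalMk_le_aleph0_of_isAlgebraic ℚ⟮j₁⟯.toSubfield
  obtain ⟨σ, hσ⟩ := Complex.exists_ringEquiv_apply_eq_of_subfield ℚ⟮j₁⟯.toSubfield hcount φ.toRingHom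
  have hσj : σ j₁ = j₀ := by
    have := hσ ⟨j₁, IntermediateField.mem_adjoin_simple_self ℚ j₁⟩
    rw [← hφj]
    exact this
  refine ⟨σ w₀, ringEquiv_apply_mem_singularModuliField hK ι σ hw₀, ?_⟩
  rw [← map_pow, hcube]
  exact hσj

/-! ### The theorem -/

/-- **Singular moduli of discriminant `d_K ≡ 1 (mod 3)` are cubes in `H_K`** (Cox Thm. 12.2 for the
maximal order, `3` split in `K`): for `K` imaginary quadratic with `d_K ≡ 1 (mod 3)`, either
embedding `ι : K → ℂ`, and every primitive positive definite form `Q₀` of discriminant `d_K`, there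
is `w` in the field of singular moduli `H_K = singularModuliField K ι` with `w³ = j(τ_{Q₀})`.
[cite: Cox2013, §12.A Thm. 12.2] -/
theorem exists_mem_singularModuliField_pow_three_eq_formJ (hK : IsImaginaryQuadratic K)
    (h3 : NumberField.discr K % 3 = 1) (ι : K →+* ℂ) {Q₀ : ℤ × ℤ × ℤ} (hA₀ : 0 < Q₀.1)
    (hprim₀ : IsPrimitive Q₀) (hdisc₀ : discr Q₀ = NumberField.discr K) :
    ∃ w ∈ singularModuliField K ι, w ^ 3 = formJ Q₀ := by
  set D := NumberField.discr K with hDdef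
  have hD : D < 0 := hK.discr_neg
  have h4 : D % 4 = 0 ∨ D % 4 = 1 := discr_emod_four hK.1
  obtain ⟨β, hβD⟩ := exists_sq_sub_dvd_thirtySix h4 h3
  -- a Heegner form of level `9` and discriminant `d_K`
  have hP1 : 0 < (principalForm D).1 := by rw [principalForm_fst]; exact one_pos
  obtain ⟨Q, hQ, hβ, -⟩ := exists_heegnerForm_formJ_eq hK (N := 9) hβD hP1
    (isPrimitive_principalForm D) (discr_principalForm h4)
  -- its Weber value is a cube root of a singular modulus, inside `H_K`
  have hmem := weberNineValue_heegnerTau_mem_singularModuliField hK h3 ι hβD hQ hβ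
  have hcube := weberNineValue_heegnerTau_pow_three hD hQ
  obtain ⟨hA'', hprim'', hdisc''⟩ := divThree_spec h3 hQ
  exact exists_mem_pow_three_eq_formJ_of_one hK ι hA'' hprim'' hdisc'' hA₀ hprim₀ hdisc₀ hmem hcube

/-- **The ideal form**: in the ring of integers of the field of singular moduli `H_K` (a number
field, `numberField_singularModuliField`), the principal ideal generated by a singular modulus
`j(τ_{Q₀})` of discriminant `d_K ≡ 1 (mod 3)` is the cube of a principal ideal.
[cite: Cox2013, §12.A Thm. 12.2 (consequence)] -/
theorem exists_span_formJ_eq_pow_three (hK : IsImaginaryQuadratic K)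
    (h3 : NumberField.discr K % 3 = 1) (ι : K →+* ℂ) {Q₀ : ℤ × ℤ × ℤ} (hA₀ : 0 < Q₀.1)
    (hprim₀ : IsPrimitive Q₀) (hdisc₀ : discr Q₀ = NumberField.discr K)
    (j₀ : 𝓞 (singularModuliField K ι)) (hj₀ : ((j₀ : singularModuliField K ι) : ℂ) = formJ Q₀) :
    ∃ w : 𝓞 (singularModuliField K ι), Ideal.span {j₀} = Ideal.span {w} ^ 3 := by
  obtain ⟨w, hwmem, hw3⟩ := exists_mem_singularModuliField_pow_three_eq_formJ hK h3 ι hA₀ hprim₀ hdisc₀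
  have hD : NumberField.discr K < 0 := hK.discr_neg
  -- `w` is an algebraic integer: `w³ = j(τ_{Q₀})` is
  have hjint : IsIntegral ℤ (formJ Q₀) := isIntegral_int_formJ hA₀ hprim₀ (by rw [hdisc₀]; exact hD)
  have hwint : IsIntegral ℤ w := IsIntegral.of_pow (by norm_num : 0 < 3) (by rw [hw3]; exact hjint)
  have hwintF : IsIntegral ℤ (⟨w, hwmem⟩ : singularModuliField K ι) :=
    (isIntegral_algHom_iff (singularModuliField K ι).subtype.toIntAlgHom Subtype.val_injective).mp hwint
  have hjF : (j₀ : singularModuliField K ι) = (⟨w, hwmem⟩ : singularModuliField K ι) ^ 3 := by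
    apply Subtype.ext
    rw [SubmonoidClass.coe_pow, hw3]
    exact hj₀
  have hj : j₀ = ⟨⟨w, hwmem⟩, hwintF⟩ ^ 3 := by
    apply NumberField.RingOfIntegers.ext
    rw [hjF, RingOfIntegers.coe_eq_algebraMap, map_pow, RingOfIntegers.map_mk]
  exact ⟨⟨⟨w, hwmem⟩, hwintF⟩, by rw [hj, Ideal.span_singleton_pow]⟩

end Literature.NumberTheory.EllipticCurves

end
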